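import Mathlib
import Literature.AlgebraicGeometry.Resolution.LocalBlowup
import Summits.ResolutionOfSingularities.ResolutionOfSingularities.Theorems.RadicialJungCleanModelsLens5PRankTwoCurrency
import Summits.ResolutionOfSingularities.ResolutionOfSingularities.Theorems.RadicialJungCleanModelsConeExitPrelims
import HarnessLib

/-!
# Route `RadicialJung`, crux `CleanModels` (stmt-15917), line `Sketch`: the exit through a `p`-th power — `h = x^{pm} · w` with `ν(w) ≤ 1`

Line lead `res-B-lead-1` g10, `--supports stmt-ResolutionOfSingularities-15917`.  Companion of ✓ `ConeExit.cleanLUConcl_of_unit_mul_pow` (exponent prime to `p`) for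
exponents DIVISIBLE by `p`: if on a regular finitely generated model a non-trivial representative of the `K^p`-line of `g₀` reads `h = x^{p·m} · w` (`x ≠ 0`; e.g. the
`p | e` case «centre OFF the tangent cone» of one quadratic transform, `w` a unit), then DIVIDING BY THE `p`-TH POWER `x^{pm}` gives the representative `w`
(coefficients `c_j / x^m`), and the line is clean as soon as `ν(w) ≤ 1`: `w` a unit whose residue is not a `p`-th power (form (2)), or `w - c'^p ∈ 𝔪 ∖ 𝔪²` for some
`c'` (form (3), ✓ `Lens5.PRankTwoCurrency.cleanLUConcl_of_parameter`).  When `ν(w) ≥ 2` nothing is claimed (the multiplicity analysis restarts with `w - c'^p`).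

Honest framing: OURS · counted 0 · elementary bookkeeping; nothing here proves resolution in characteristic `p`.
-/

noncomputable section

set_option linter.dupNamespace false

open IsLocalRing
open Literature.AlgebraicGeometry.Resolution
open Summit.ResolutionOfSingularities.ResolutionOfSingularities.Theorems.RadicialJung.CleanModels.Lens5.PRankTwoCurrency

namespace Summit.ResolutionOfSingularities.ResolutionOfSingularities.Theorems.RadicialJung.CleanModels.ConeExit

/-- **Dividing a representative by a `p`-th power keeps it in the line**: if `Σ c_j^p g₀^j = x^{pm} · w` with `x ≠ 0`, then `Σ (c_j/x^m)^p g₀^j = w`, and the new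
coefficient vector is non-trivial when the old one is. [folklore] -/
theorem rep_div_pow {p : ℕ} {K : Type} [Field K] (g₀ x w : K) (hx : x ≠ 0) (m : ℕ) (c : Fin p → K)
    (hc : ∑ j : Fin p, c j ^ p * g₀ ^ (j : ℕ) = x ^ (p * m) * w) :
    (∑ j : Fin p, (c j / x ^ m) ^ p * g₀ ^ (j : ℕ)) = w ∧
      ((∃ j : Fin p, (j : ℕ) ≠ 0 ∧ c j ≠ 0) → ∃ j : Fin p, (j : ℕ) ≠ 0 ∧ c j / x ^ m ≠ 0) := by
  have hxm : x ^ m ≠ 0 := pow_ne_zero m hx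
  have hxpm : x ^ (p * m) ≠ 0 := pow_ne_zero _ hx
  refine ⟨?_, ?_⟩
  · have : ∑ j : Fin p, (c j / x ^ m) ^ p * g₀ ^ (j : ℕ) = (∑ j : Fin p, c j ^ p * g₀ ^ (j : ℕ)) / x ^ (p * m) := by
      rw [Finset.sum_div]
      refine Finset.sum_congr rfl fun j _ => ?_
      rw [div_pow, ← pow_mul, mul_comm m p]
      ring
    rw [this, hc, mul_div_cancel_left₀ _ hxpm]
  · rintro ⟨j, hj, hcj⟩
    exact ⟨j, hj, div_ne_zero hcj hxm⟩

/-- **EXIT THROUGH A `p`-TH POWER.**  On a finitely generated model `A ⊆ A'' ⊆ O` regular at the centre of `O`, a non-trivial representative `h = x^{pm} · w` of the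
`K^p`-line of `g₀` (`x ≠ 0`) with `ν(w) ≤ 1` — `w` a unit with residue not a `p`-th power, or `w - c'^p ∈ 𝔪 ∖ 𝔪²` for some `c'` — gives `CleanLUConcl p k K O A g₀`
(form (2) resp. (3) for the representative `w = Σ (c_j/x^m)^p g₀^j`). [folklore] -/
theorem cleanLUConcl_of_pow_p_mul {p : ℕ} [Fact p.Prime] {k K : Type} [Field k] [Field K] [Algebra k K]
[CharP K p]
    (O : ValuationSubring K) (A A'' : Subalgebra k K) [IsFractionRing A K]
    (hA''O : A''.toSubring ≤ O.toSubring) (hAA'' : A ≤ A'') (hA''fg : A''.FG)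
    (hreg : IsRegularLocalRing (locAtCentre A''.toSubring O)) (g₀ : K)
    (x : K) (hx : x ≠ 0) (m : ℕ) (w : locAtCentre A''.toSubring O)
    (hw : (IsUnit w ∧ ∀ c' : locAtCentre A''.toSubring O, w - c' ^ p ∉ maximalIdeal (locAtCentre A''.toSubring O)) ∨
      (∃ c' : locAtCentre A''.toSubring O, w - c' ^ p ∈ maximalIdeal (locAtCentre A''.toSubring O) ∧
        w - c' ^ p ∉ maximalIdeal (locAtCentre A''.toSubring O) ^ 2))
    (c : Fin p → K) (hc0 : ∃ j : Fin p, (j : ℕ) ≠ 0 ∧ c j ≠ 0)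
    (hc : ∑ j : Fin p, c j ^ p * g₀ ^ (j : ℕ) = x ^ (p * m) * (w : K)) :
    CleanLUConcl p k K O A g₀ := by
  classical
  have hp : p.Prime := Fact.out
  obtain ⟨hrep, hnt⟩ := rep_div_pow g₀ x (w : K) hx m c hc
  have hc0' := hnt hc0
  rcases hw with ⟨hwu, hres⟩ | ⟨c', hc'1, hc'2⟩
  · exact cleanLUConcl_of_unit_residue O A A'' hA''O hAA'' hA''fg hreg g₀ w hwu hres (fun j => c j / x ^ m) hc0' hrep
  · -- form (3) with the representative `w - c'^p`: shift the constant coefficient by `c'`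
    haveI := hreg
    let j0 : Fin p := ⟨0, hp.pos⟩
    let c₂ : Fin p → K := fun j => if j = j0 then c j / x ^ m - (c' : K) else c j / x ^ m
    have hsum : ∑ j : Fin p, c₂ j ^ p * g₀ ^ (j : ℕ) = (∑ j : Fin p, (c j / x ^ m) ^ p * g₀ ^ (j : ℕ)) - (c' : K) ^ p := by
      rw [← Finset.add_sum_erase Finset.univ _ (Finset.mem_univ j0),
        ← Finset.add_sum_erase Finset.univ (fun j => (c j / x ^ m) ^ p * g₀ ^ (j : ℕ)) (Finset.mem_univ j0)]
      have hj0 : ((j0 : Fin p) : ℕ) = 0 := rfl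
      have hrest : ∑ j ∈ Finset.univ.erase j0, c₂ j ^ p * g₀ ^ (j : ℕ) =
          ∑ j ∈ Finset.univ.erase j0, (c j / x ^ m) ^ p * g₀ ^ (j : ℕ) :=
        Finset.sum_congr rfl fun j hj => by simp only [c₂, if_neg (Finset.ne_of_mem_erase hj)]
      rw [hrest]
      simp only [c₂, if_pos rfl, hj0, pow_zero, mul_one, sub_pow_char]
      ring
    have hsum' : ∑ j : Fin p, c₂ j ^ p * g₀ ^ (j : ℕ) = ((w - c' ^ p : locAtCentre A''.toSubring O) : K) := by
      rw [hsum, hrep]; simp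
    have _hc₂ : ∃ j : Fin p, (j : ℕ) ≠ 0 ∧ c₂ j ≠ 0 := by
      obtain ⟨j, hj, hcj⟩ := hc0'
      refine ⟨j, hj, ?_⟩
      have hjne : j ≠ j0 := fun h => hj (by rw [h])
      simp only [c₂, if_neg hjne]
      exact hcj
    exact cleanLUConcl_of_parameter O A A'' hA''O hAA'' hA''fg hreg g₀ (w - c' ^ p) hc'1 hc'2 c₂ hsum'

end Summit.ResolutionOfSingularities.ResolutionOfSingularities.Theorems.RadicialJung.CleanModels.ConeExit

end
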